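import Mathlib
import HarnessLib

/-!
# Route `DiophantineDichotomy`, crux `KhovanskiiApproxTypeEv` (stmt-Schanuel-14972), line `lambert-liouville-kill`:
# stub `stub_expRationalSlotHeight` — height of the exp-rational slot `B(p/q)/A(p/q)`

Crux `Summit.Schanuel.Schanuel.Theses.DiophantineDichotomy.KhovanskiiApproxTypeEv` (item stmt-Schanuel-14972),
certificate line `lambert-liouville-kill` (skeleton `Cruxes/KhovanskiiApproxTypeEv/Lines/lambert_liouville_kill.lean`,
lead `prover-line-stmt-Schanuel-14972-a1-0`), registered stub `stub_expRationalSlotHeight` (landed `--supports stmt-Schanuel-14972`).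

In the exp-rational extension of the certificate (`notLiouville_expRational_of_ev`, consuming STUB F3a) the
last slot `eˣ = B(x)/A(x)` of the point `(1, x, e, eˣ)` is approximated by the rational number
`B(p/q)/A(p/q)` at a Liouville scale `p/q` of `x`; this stub controls its height.  For `A, B ∈ ℤ[X]` put
`D := max (deg A) (deg B)` and `L := 1 + Σ_{i ≤ D} |a_i| + Σ_{i ≤ D} |b_i|`.  At a rational `p/q` (`q ≥ 1`)
with `A(p/q) ≠ 0` the integers `u := q^D A(p/q) = Σ a_i p^i q^{D-i}` and `v := q^D B(p/q)` satisfy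
`u ≠ 0`, `u · (B(p/q)/A(p/q)) = v` and `|u|, |v| ≤ L · max(|p|, q)^D` (each term `|c_i| |p|^i q^{D-i}` is
at most `|c_i| M^D`, `M := max(|p|, q)`).  The cleared sum is handled once in `clearedSum_cast`
(`Polynomial.aeval_eq_sum_range'`) and `clearedSum_abs_le` (`Finset.abs_sum_le_sum_abs`).  Pure Mathlib;
no tree inputs.
-/

noncomputable section

-- `Summit.Schanuel.Schanuel.…` is the mandated summit/sub-problem namespace (single-conjunct summit), hence:
set_option linter.dupNamespace false

namespace Summit.Schanuel.Schanuel.Cruxes.KhovanskiiApproxTypeEv.LambertLiouvilleKill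

open Polynomial

/-- The cleared sum `Σ_{i ≤ D} c_i p^i q^{D-i}` of `R = Σ c_i Xⁱ ∈ ℤ[X]` (`deg R ≤ D`) at `p/q` (`q ≥ 1`),
cast to `ℝ`, equals `q^D · R(p/q)`. [folklore] -/
theorem clearedSum_cast (R : ℤ[X]) (D : ℕ) (hD : R.natDegree ≤ D) (p : ℤ) (q : ℕ) (hq : 1 ≤ q) :
    ((∑ i ∈ Finset.range (D + 1), R.coeff i * p ^ i * (q : ℤ) ^ (D - i) : ℤ) : ℝ) =
      (q : ℝ) ^ D * Polynomial.aeval ((p : ℝ) / q) R := by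
  have hq0 : (q : ℝ) ≠ 0 := Nat.cast_ne_zero.mpr (by omega)
  rw [Polynomial.aeval_eq_sum_range' (Nat.lt_succ_of_le hD), Finset.mul_sum]
  simp only [Algebra.smul_def, eq_intCast]
  push_cast
  refine Finset.sum_congr rfl fun i hi => ?_
  have hi' : i ≤ D := Nat.lt_succ_iff.mp (Finset.mem_range.mp hi)
  have hsplit : (q : ℝ) ^ D = (q : ℝ) ^ i * (q : ℝ) ^ (D - i) := by
    rw [← pow_add, Nat.add_sub_cancel' hi']
  rw [div_pow, hsplit]
  field_simp

/-- The cleared sum `Σ_{i ≤ D} c_i p^i q^{D-i}` is bounded in absolute value by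
`(Σ_{i ≤ D} |c_i|) · max(|p|, q)^D`. [folklore] -/
theorem clearedSum_abs_le (R : ℤ[X]) (D : ℕ) (p : ℤ) (q : ℕ) :
    |∑ i ∈ Finset.range (D + 1), R.coeff i * p ^ i * (q : ℤ) ^ (D - i)| ≤
      (∑ i ∈ Finset.range (D + 1), |R.coeff i|) * (max |p| (q : ℤ)) ^ D := by
  rw [Finset.sum_mul]
  refine (Finset.abs_sum_le_sum_abs _ _).trans (Finset.sum_le_sum fun i hi => ?_)
  have hi' : i ≤ D := Nat.lt_succ_iff.mp (Finset.mem_range.mp hi)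
  have hM0 : (0 : ℤ) ≤ max |p| (q : ℤ) := (abs_nonneg p).trans (le_max_left _ _)
  rw [abs_mul, abs_mul, abs_pow, abs_pow, Int.abs_natCast]
  calc |R.coeff i| * |p| ^ i * (q : ℤ) ^ (D - i)
      ≤ |R.coeff i| * (max |p| (q : ℤ)) ^ i * (max |p| (q : ℤ)) ^ (D - i) := by
        gcongr
        · exact le_max_left _ _
        · exact le_max_right _ _
    _ = |R.coeff i| * (max |p| (q : ℤ)) ^ D := by
        rw [mul_assoc, ← pow_add, Nat.add_sub_cancel' hi']

/-- Pointwise form of the slot height bound with explicit constants: for `deg A, deg B ≤ D`, `q ≥ 1` and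
`A(p/q) ≠ 0`, the integers `u := q^D A(p/q)`, `v := q^D B(p/q)` satisfy `u ≠ 0`,
`u · (B(p/q)/A(p/q)) = v`, `|u| ≤ (Σ |a_i|) max(|p|, q)^D`, `|v| ≤ (Σ |b_i|) max(|p|, q)^D`. [folklore] -/
theorem expRationalSlotHeight_at (A B : ℤ[X]) (D : ℕ) (hDA : A.natDegree ≤ D)
    (hDB : B.natDegree ≤ D) (p : ℤ) (q : ℕ) (hq : 1 ≤ q)
    (hA : Polynomial.aeval ((p : ℝ) / q) A ≠ 0) :
    ∃ u v : ℤ, u ≠ 0 ∧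
      (u : ℝ) * (Polynomial.aeval ((p : ℝ) / q) B / Polynomial.aeval ((p : ℝ) / q) A) = v ∧
      |u| ≤ (∑ i ∈ Finset.range (D + 1), |A.coeff i|) * (max |p| (q : ℤ)) ^ D ∧
      |v| ≤ (∑ i ∈ Finset.range (D + 1), |B.coeff i|) * (max |p| (q : ℤ)) ^ D := by
  have hq0 : (q : ℝ) ≠ 0 := Nat.cast_ne_zero.mpr (by omega)
  have hqD : (q : ℝ) ^ D ≠ 0 := pow_ne_zero _ hq0
  have huR := clearedSum_cast A D hDA p q hq
  have hvR := clearedSum_cast B D hDB p q hq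
  refine ⟨∑ i ∈ Finset.range (D + 1), A.coeff i * p ^ i * (q : ℤ) ^ (D - i),
    ∑ i ∈ Finset.range (D + 1), B.coeff i * p ^ i * (q : ℤ) ^ (D - i), ?_, ?_,
    clearedSum_abs_le A D p q, clearedSum_abs_le B D p q⟩
  · intro hu0
    have h : (q : ℝ) ^ D * Polynomial.aeval ((p : ℝ) / q) A = 0 := by
      rw [← huR]
      exact_mod_cast hu0
    exact mul_ne_zero hqD hA h
  · rw [huR, hvR, mul_assoc, mul_div_cancel₀ _ hA]

/-- **STUB F3a (height of the exp-rational slot).**  For `A, B ∈ ℤ[X]` there are `L ≥ 1` and `D` such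
that at every rational `p/q` (`q ≥ 1`) with `A(p/q) ≠ 0` the value `B(p/q)/A(p/q)` is `v/u` with integers
`u ≠ 0`, `v`, `|u|, |v| ≤ L · max(|p|, q)^D`.  Take `D := max (deg A) (deg B)`,
`L := 1 + Σ_{i ≤ D} |a_i| + Σ_{i ≤ D} |b_i|`, `u := q^D A(p/q)`, `v := q^D B(p/q)`
(`expRationalSlotHeight_at`). [folklore] -/
theorem stub_expRationalSlotHeight :
    ∀ (A B : ℤ[X]), ∃ L D : ℕ, 1 ≤ L ∧ ∀ (p : ℤ) (q : ℕ), 1 ≤ q →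
      Polynomial.aeval ((p : ℝ) / q) A ≠ 0 →
      ∃ u v : ℤ, u ≠ 0 ∧
        (u : ℝ) * (Polynomial.aeval ((p : ℝ) / q) B / Polynomial.aeval ((p : ℝ) / q) A) = v ∧
        |u| ≤ (L : ℤ) * (max |p| (q : ℤ)) ^ D ∧ |v| ≤ (L : ℤ) * (max |p| (q : ℤ)) ^ D := by
  intro A B
  set D : ℕ := max A.natDegree B.natDegree with hD
  set SA : ℤ := ∑ i ∈ Finset.range (D + 1), |A.coeff i| with hSA
  set SB : ℤ := ∑ i ∈ Finset.range (D + 1), |B.coeff i| with hSB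
  have hSA0 : 0 ≤ SA := Finset.sum_nonneg fun i _ => abs_nonneg _
  have hSB0 : 0 ≤ SB := Finset.sum_nonneg fun i _ => abs_nonneg _
  have hL : (((1 + SA + SB).toNat : ℕ) : ℤ) = 1 + SA + SB := Int.toNat_of_nonneg (by linarith)
  refine ⟨(1 + SA + SB).toNat, D, ?_, ?_⟩
  · have h1 : (1 : ℤ) ≤ (((1 + SA + SB).toNat : ℕ) : ℤ) := by rw [hL]; linarith
    exact_mod_cast h1
  · intro p q hq hA
    obtain ⟨u, v, hu0, huv, hu, hv⟩ :=
      expRationalSlotHeight_at A B D (le_max_left _ _) (le_max_right _ _) p q hq hA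
    have hM0 : (0 : ℤ) ≤ (max |p| (q : ℤ)) ^ D :=
      pow_nonneg ((abs_nonneg p).trans (le_max_left _ _)) D
    refine ⟨u, v, hu0, huv, ?_, ?_⟩
    · calc |u| ≤ SA * (max |p| (q : ℤ)) ^ D := hu
        _ ≤ (((1 + SA + SB).toNat : ℕ) : ℤ) * (max |p| (q : ℤ)) ^ D := by
          rw [hL]
          exact mul_le_mul_of_nonneg_right (by linarith) hM0
    · calc |v| ≤ SB * (max |p| (q : ℤ)) ^ D := hv
        _ ≤ (((1 + SA + SB).toNat : ℕ) : ℤ) * (max |p| (q : ℤ)) ^ D := by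
          rw [hL]
          exact mul_le_mul_of_nonneg_right (by linarith) hM0

end Summit.Schanuel.Schanuel.Cruxes.KhovanskiiApproxTypeEv.LambertLiouvilleKill

end
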